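import Literature.AlgebraicGeometry.Resolution.StalkBaseChangeCompletion
import Literature.AlgebraicGeometry.Resolution.SemiStableCurvesBaseChange
import HarnessLib

/-!
# `WildQuotients.SummitReduction` (stmt-ResolutionOfSingularities-16324), line `FramePerfect`:
# completed local rings of `W ×_{Spec D} Spec E` at the points over `w₀`, COMPATIBLY with the
# first projection, and the structure maps from the base into stalks
# (geometry of stub `stub_pair_orbitBlowupCentreLocal`, file 1)

Route `ResolutionOfSingularities/WildQuotients`, crux `SummitReduction`; helper file of stub
`stub_pair_orbitBlowupCentreLocal` (C2: de Jong 1996, 3.4 Claim (ii) over the orbit centre — the local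
structure of the blown-up curve `X₁` at its points over `cl(G · x)`) of the line skeleton
`Cruxes/SummitReduction/Lines/FramePerfect.lean` (v8). "We remark that completion and blowing up
commute in a suitable manner" (de Jong 1996, p. 64, l. 1–2) is used three times in the stub (the
blown-up curve `X₁` against `X₁ ×_X Spec 𝒪̂_{X,z}`; the latter against the blow-up of the algebraic
model `B' = Λ[u, v]/(uv - c t²)`; and once more for the geometric fibres), each time in the form of
the tree's `nonempty_localCpl_stalkOver_ringEquiv_localCpl_stalk_pullback`
(`StalkBaseChangeCompletion.lean`): for `q : W → Spec D`, a `D`-algebra `E` bijective on all levels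
`D/𝔭ⁿ → E/𝔭ⁿE` of an ideal `𝔭` mapping into `𝔪_{w₀}`, the completed local ring of `W ×_{Spec D} Spec E`
at its (unique) point `w` over `w₀` is `𝒪̂_{W,w₀}`. The stub has to track the structure maps from the
base `Y` through these identifications, so this file

* re-proves that statement WITH ITS COMPATIBILITY: the isomorphism extends the stalk map of the first
  projection (`exists_localCpl_equiv_stalk_pullback_forall_of`, registered sub-goal). The one new
  ingredient is the identification of the algebra structure of the local ring at `w` used in the
  tree's proof with the stalk map of `pullback.fst` (`stalkMap_stalkTensorChart_comp_eq`), by the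
  `Spec`-adjunction: two ring maps out of `𝒪_{W,w₀}` into a local ring agree as soon as the induced
  morphisms `Spec(·) → Spec 𝒪_{W,w₀} → W` agree, `Spec 𝒪_{W,w₀} → W` being a monomorphism
  (`stalk_hom_ext_of_specMap_comp_fromSpecStalk_eq`);
* records how the `Λ`-structure of a stalk of a `Λ`-scheme (the tree's `StalkOver g p`,
  `g : P → Spec Λ`) passes along stalk maps of morphisms over `Spec Λ`, along equalities of points,
  along composition with `Spec β`, to the stalks of `Spec S` (which are the localizations `S_s`), and
  to completions (`stalkMap_comp_algebraMap_stalkOver`, `stalkCongr_hom_comp_algebraMap_stalkOver`,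
  `algebraMap_stalkOver_comp_specMap`, `algebraMap_stalkOver_specMap`,
  `exists_stalk_ringEquiv_localization_specMap`, `exists_localization_ringEquiv_of_ringEquiv`,
  `exists_localCpl_equiv_of_ringEquiv`) — the bookkeeping of "compatibly with the structure maps".
-/

set_option linter.dupNamespace false

noncomputable section

open CategoryTheory CategoryTheory.Limits AlgebraicGeometry TopologicalSpace TensorProduct
open Literature.AlgebraicGeometry.Resolution
open IsLocalRing

namespace Summit.ResolutionOfSingularities.ResolutionOfSingularities.Theorems

universe u

/-! ## The completed local ring of `W ×_{Spec D} Spec E` at the point over `w₀` -/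

section CompletionBaseChange

variable {D : Type u} [CommRing D] (E : Type u) [CommRing E] [Algebra D E] {W : Scheme.{u}}
  (q : W ⟶ Spec (.of D)) (w₀ : W)

/-- **Two ring maps out of a stalk `𝒪_{W,w₀}` agree as soon as the induced morphisms
`Spec R → Spec 𝒪_{W,w₀} → W` agree** (`Spec` is fully faithful and `Spec 𝒪_{W,w₀} → W` is a
monomorphism, being a preimmersion). [folklore] -/
theorem stalk_hom_ext_of_specMap_comp_fromSpecStalk_eq {R : CommRingCat.{u}}
    {α β : W.presheaf.stalk w₀ ⟶ R}
    (h : Spec.map α ≫ W.fromSpecStalk w₀ = Spec.map β ≫ W.fromSpecStalk w₀) : α = β :=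
  Spec.map_injective ((cancel_mono (W.fromSpecStalk w₀)).mp h)

/-- **The chart `Spec (𝒪_{W,w₀} ⊗_D E) → W ×_{Spec D} Spec E` is compatible with the first
projection on local rings**: for a point `t` of the chart, the composite
`𝒪_{W,w₀} ≅ 𝒪_{W, pr₁(chart t)} → 𝒪_{W ×_D E, chart t} → 𝒪_{Spec(𝒪_{W,w₀} ⊗_D E), t}` (the first
arrow being the identification of stalks at equal points, the other two the stalk maps) is
`c ↦ germ of c ⊗ 1`. [folklore] -/
theorem stalkMap_stalkTensorChart_comp_eq (t : Spec (.of (StalkOver q w₀ ⊗[D] E)))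
    (ht : pullback.fst q (specOfAlgebra D E) (stalkTensorChart E q w₀ t) = w₀) :
    (W.presheaf.stalkCongr (.of_eq ht.symm)).hom ≫
        (pullback.fst q (specOfAlgebra D E)).stalkMap (stalkTensorChart E q w₀ t) ≫
          (stalkTensorChart E q w₀).stalkMap t =
      (StalkOver.iso q w₀).hom ≫ CommRingCat.ofHom (Algebra.TensorProduct.includeLeftRingHom
        (R := D) (A := StalkOver q w₀) (B := E)) ≫
        StructureSheaf.toStalk (StalkOver q w₀ ⊗[D] E) t := by
  apply stalk_hom_ext_of_specMap_comp_fromSpecStalk_eq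
  -- left: `Spec 𝒪_t → chart → pr₁`
  have hl : Spec.map ((W.presheaf.stalkCongr (.of_eq ht.symm)).hom ≫
      (pullback.fst q (specOfAlgebra D E)).stalkMap (stalkTensorChart E q w₀ t) ≫
        (stalkTensorChart E q w₀).stalkMap t) ≫ W.fromSpecStalk w₀ =
      (Spec (.of (StalkOver q w₀ ⊗[D] E))).fromSpecStalk t ≫ stalkTensorChart E q w₀ ≫
        pullback.fst q (specOfAlgebra D E) := by
    rw [Spec.map_comp, Spec.map_comp, Category.assoc, Category.assoc,
      TopCat.Presheaf.stalkCongr_hom, Scheme.SpecMap_stalkSpecializes_fromSpecStalk,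
      Scheme.SpecMap_stalkMap_fromSpecStalk, Scheme.SpecMap_stalkMap_fromSpecStalk_assoc]
  -- right: `Spec 𝒪_t → Spec (C ⊗ E) → Spec C → W`
  have hr : Spec.map ((StalkOver.iso q w₀).hom ≫ CommRingCat.ofHom
      (Algebra.TensorProduct.includeLeftRingHom (R := D) (A := StalkOver q w₀) (B := E)) ≫
        StructureSheaf.toStalk (StalkOver q w₀ ⊗[D] E) t) ≫ W.fromSpecStalk w₀ =
      (Spec (.of (StalkOver q w₀ ⊗[D] E))).fromSpecStalk t ≫ stalkTensorChart E q w₀ ≫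
        pullback.fst q (specOfAlgebra D E) := by
    rw [Spec.map_comp, Spec.map_comp, Category.assoc, Category.assoc, Spec.fromSpecStalk_eq',
      stalkTensorChart, specTensorChart_fst]
    rfl
  exact hl.trans hr.symm

end CompletionBaseChange

section Main

/-- **The completed local ring of `W ×_{Spec D} Spec E` at a point `w` over `w₀` is `𝒪̂_{W,w₀}`,
compatibly with the first projection** — when `D → E` is bijective on all levels `D/𝔭ⁿ → E/𝔭ⁿE`
for an ideal `𝔭` mapping into `𝔪_{w₀}` (e.g. `E` the completion of a local `D`, or the formal model
`B' → Λ⟦u, v⟧/(uv - c t²)` of de Jong 1996, 3.3). The tree's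
`nonempty_localCpl_stalkOver_ringEquiv_localCpl_stalk_pullback` re-run with the bookkeeping: the
isomorphism is `𝒪̂_{W,w₀} ≅ (E ⊗_D 𝒪_{W,w₀})^_{𝔪_{w₀}}` (`completionTensorBaseEquiv`, `c ↦ 1 ⊗ c`)
followed by the completion of the localisation `E ⊗_D 𝒪_{W,w₀} → 𝒪_{W ×_D E, w}`
(`adicCompletionEquivOfIsLocalizationAtMaximal`), and the latter algebra structure is the stalk map
of `pullback.fst` (`stalkMap_stalkTensorChart_comp_eq`). ("completion and blowing up commute in a
suitable manner", de Jong 1996, p. 64.) [cite: DeJong1996, 3.4 Claim (ii), p. 64] -/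
theorem exists_localCpl_equiv_stalk_pullback_forall_of {D : Type u} [CommRing D] (E : Type u)
    [CommRing E] [Algebra D E] {W : Scheme.{u}} (q : W ⟶ Spec (.of D)) (w₀ : W) (𝔭 : Ideal D)
    (hR' : ∀ n, Function.Bijective
      (Ideal.quotientMap ((𝔭 ^ n).map (algebraMap D E)) (algebraMap D E) Ideal.le_comap_map))
    (h𝔫 : 𝔭.map (algebraMap D (StalkOver q w₀)) ≤ localMaxIdeal (StalkOver q w₀))
    (w : ↑(pullback q (specOfAlgebra D E))) (hw : pullback.fst q (specOfAlgebra D E) w = w₀) :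
    ∃ e : LocalCpl (StalkOver q w₀) ≃+* LocalCpl ((pullback q (specOfAlgebra D E)).presheaf.stalk w),
      ∀ c : StalkOver q w₀, e (AdicCompletion.of _ _ c) = AdicCompletion.of _ _
        (((pullback.fst q (specOfAlgebra D E)).stalkMap w).hom
          ((W.presheaf.stalkCongr (.of_eq hw.symm)).hom c)) := by
  classical
  set C := StalkOver q w₀ with hC
  set 𝔫 : Ideal C := localMaxIdeal C with h𝔫def
  -- the point of the chart over `w`
  obtain ⟨t, rfl⟩ := exists_stalkTensorChart_eq E q w₀ w (by rw [hw])
  set P := pullback q (specOfAlgebra D E)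
  set L : Type u := ↥(P.presheaf.stalk (stalkTensorChart E q w₀ t)) with hL
  set St : Type u := ↥((Spec (.of (C ⊗[D] E))).presheaf.stalk t) with hSt
  -- `L ≅ (C ⊗ E)_t`, so `L` is a localization of `C ⊗ E` at `t`
  let φ : P.presheaf.stalk (stalkTensorChart E q w₀ t) ≅ (Spec (.of (C ⊗[D] E))).presheaf.stalk t :=
    asIso ((stalkTensorChart E q w₀).stalkMap t)
  letI algSt : Algebra (C ⊗[D] E) St := (StructureSheaf.toStalk (C ⊗[D] E) t).hom.toAlgebra
  haveI hlocSt : IsLocalization.AtPrime St t.asIdeal := StructureSheaf.IsLocalization.to_stalk (C ⊗[D] E) t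
  letI algL : Algebra (C ⊗[D] E) L := (φ.inv.hom.comp (algebraMap (C ⊗[D] E) St)).toAlgebra
  haveI hlocL : IsLocalization.AtPrime L t.asIdeal := by
    let ε : St ≃ₐ[C ⊗[D] E] L :=
      AlgEquiv.ofRingEquiv (f := φ.symm.commRingCatIsoToRingEquiv) (fun x => rfl)
    exact IsLocalization.isLocalization_of_algEquiv t.asIdeal.primeCompl ε
  -- switch the factors: `E ⊗ C`
  let κ : (C ⊗[D] E) ≃+* (E ⊗[D] C) := (Algebra.TensorProduct.comm D C E).toRingEquiv
  letI algL' : Algebra (E ⊗[D] C) L := ((algebraMap (C ⊗[D] E) L).comp κ.symm.toRingHom).toAlgebra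
  haveI hloc' : IsLocalization (t.asIdeal.primeCompl.map κ) L :=
    IsLocalization.isLocalization_of_base_ringEquiv t.asIdeal.primeCompl L κ
  -- the prime of `E ⊗ C` below the point is `𝔫' = 𝔪_{w₀}(E ⊗ C)`
  set 𝔫' : Ideal (E ⊗[D] C) := 𝔫.map (tensorInr D E C) with h𝔫'
  haveI : 𝔫.IsMaximal := IsLocalRing.maximalIdeal.isMaximal C
  haveI h𝔫'max : 𝔫'.IsMaximal := isMaximal_map_tensorInr 𝔭 hR' 𝔫 h𝔫
  set Q : Ideal (E ⊗[D] C) := t.asIdeal.comap κ.symm.toRingHom with hQ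
  haveI hQp : Q.IsPrime := Ideal.comap_isPrime _ _
  have hle : 𝔫' ≤ Q := by
    rw [h𝔫', Ideal.map_le_iff_le_comap]
    intro c hc
    rw [Ideal.mem_comap, hQ, Ideal.mem_comap]
    have h1 : κ.symm.toRingHom (tensorInr D E C c) =
        Algebra.TensorProduct.includeLeftRingHom (R := D) (A := C) (B := E) c := by
      change (Algebra.TensorProduct.comm D C E).symm ((1 : E) ⊗ₜ[D] c) = c ⊗ₜ[D] (1 : E)
      rfl
    rw [h1]
    exact map_maximalIdeal_le_asIdeal E q w₀ hw (Ideal.mem_map_of_mem _ hc)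
  have hQeq : Q = 𝔫' := (Ideal.IsMaximal.eq_of_le h𝔫'max hQp.ne_top hle).symm
  -- so `L` is a localization of `E ⊗ C` at the maximal ideal `𝔫'`
  have hsub : t.asIdeal.primeCompl.map κ = 𝔫'.primeCompl := by
    ext x
    rw [Ideal.mem_primeCompl_iff, ← hQeq, hQ, Ideal.mem_comap, Submonoid.mem_map]
    constructor
    · rintro ⟨y, hy, rfl⟩
      change κ.symm.toRingHom (κ y) ∉ t.asIdeal
      rwa [RingEquiv.toRingHom_eq_coe, RingHom.coe_coe, RingEquiv.symm_apply_apply]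
    · intro hx
      exact ⟨κ.symm x, hx, κ.apply_symm_apply x⟩
  haveI : IsLocalization.AtPrime L 𝔫' := by
    have h := hloc'
    rw [hsub] at h
    exact h
  -- the two completion isomorphisms
  let e₁ : AdicCompletion 𝔫 C ≃+* AdicCompletion 𝔫' (E ⊗[D] C) := completionTensorBaseEquiv 𝔭 hR' 𝔫 h𝔫
  let e₂ : AdicCompletion 𝔫' (E ⊗[D] C) ≃+* LocalCpl L :=
    adicCompletionEquivOfIsLocalizationAtMaximal 𝔫' L
  refine ⟨e₁.trans e₂, fun c => ?_⟩
  rw [RingEquiv.trans_apply]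
  erw [completionTensorBaseEquiv_of 𝔭 hR' 𝔫 h𝔫 c]
  rw [adicCompletionEquivOfIsLocalizationAtMaximal_of]
  congr 1
  -- the algebra structure of `L` versus the stalk map of `pullback.fst`
  change φ.inv.hom (StructureSheaf.toStalk (C ⊗[D] E) t (κ.symm ((1 : E) ⊗ₜ[D] c))) = _
  have hk : κ.symm ((1 : E) ⊗ₜ[D] c) = Algebra.TensorProduct.includeLeftRingHom
      (R := D) (A := C) (B := E) c := rfl
  rw [hk]
  apply φ.commRingCatIsoToRingEquiv.injective
  change φ.hom.hom (φ.inv.hom _) = φ.hom.hom _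
  rw [← CommRingCat.comp_apply φ.inv φ.hom, φ.inv_hom_id, CommRingCat.id_apply]
  have key := congrArg (fun f => f.hom c) (stalkMap_stalkTensorChart_comp_eq E q w₀ t hw)
  simp only [CommRingCat.hom_comp, RingHom.comp_apply] at key
  exact key.symm


end Main

/-! ## Toolkit: structure maps from the base into stalks -/

section StalkOverTools

variable {Λ : Type u} [CommRing Λ]

/-- `StalkOver.fromSpec` is `fromSpecStalk` (the identification `StalkOver.iso` is the identity).
[folklore] -/
theorem stalkOver_fromSpec_eq {P : Scheme.{u}} (g : P ⟶ Spec (.of Λ)) (p : P) :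
    StalkOver.fromSpec g p = P.fromSpecStalk p := by
  rw [StalkOver.fromSpec, StalkOver.iso, Iso.refl_hom]
  erw [Spec.map_id]
  exact Category.id_comp _

/-- **Stalk maps of morphisms over `Spec Λ` are `Λ`-algebra maps** for the `Λ`-structures of
`StalkOver`: for `h : P₁ → P₂` with `h ≫ g₂ = g₁`, `h^#_p ∘ (Λ → 𝒪_{P₂, h p}) = (Λ → 𝒪_{P₁, p})`.
[folklore] -/
theorem stalkMap_comp_algebraMap_stalkOver {P₁ P₂ : Scheme.{u}} (h : P₁ ⟶ P₂)
    (g₁ : P₁ ⟶ Spec (.of Λ)) (g₂ : P₂ ⟶ Spec (.of Λ)) (hg : h ≫ g₂ = g₁) (p : P₁) :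
    (h.stalkMap p).hom.comp (algebraMap Λ (StalkOver g₂ (h p))) = algebraMap Λ (StalkOver g₁ p) := by
  have key : Spec.map (CommRingCat.ofHom ((h.stalkMap p).hom.comp
      (algebraMap Λ (StalkOver g₂ (h p))))) =
      Spec.map (CommRingCat.ofHom (algebraMap Λ (StalkOver g₁ p))) := by
    rw [← fromSpecStalk_comp_eq g₁ p, CommRingCat.ofHom_comp, Spec.map_comp, CommRingCat.ofHom_hom]
    erw [← fromSpecStalk_comp_eq g₂ (h p)]
    rw [stalkOver_fromSpec_eq, stalkOver_fromSpec_eq]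
    erw [Scheme.SpecMap_stalkMap_fromSpecStalk_assoc]
    rw [hg]
    rfl
  exact congrArg CommRingCat.Hom.hom (Spec.map_injective key)

/-- Pointwise form of `stalkMap_comp_algebraMap_stalkOver`. [folklore] -/
theorem stalkMap_algebraMap_stalkOver {P₁ P₂ : Scheme.{u}} (h : P₁ ⟶ P₂)
    (g₁ : P₁ ⟶ Spec (.of Λ)) (g₂ : P₂ ⟶ Spec (.of Λ)) (hg : h ≫ g₂ = g₁) (p : P₁) (a : Λ) :
    (h.stalkMap p).hom (algebraMap Λ (StalkOver g₂ (h p)) a) = algebraMap Λ (StalkOver g₁ p) a :=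
  congrArg (fun f => f a) (stalkMap_comp_algebraMap_stalkOver h g₁ g₂ hg p)

/-- Transport of the `Λ`-structure of `StalkOver` along an equality of points. [folklore] -/
theorem stalkCongr_hom_comp_algebraMap_stalkOver {P : Scheme.{u}} (g : P ⟶ Spec (.of Λ))
    {p₁ p₂ : P} (h : p₁ = p₂) :
    (P.presheaf.stalkCongr (.of_eq h)).hom.hom.comp (algebraMap Λ (StalkOver g p₁)) =
      algebraMap Λ (StalkOver g p₂) := by
  subst h
  have : (P.presheaf.stalkCongr (.of_eq (rfl : p₁ = p₁))).hom = 𝟙 _ :=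
    TopCat.Presheaf.stalkSpecializes_refl _ _
  rw [this]
  rfl

/-- Pointwise form of `stalkCongr_hom_comp_algebraMap_stalkOver`. [folklore] -/
theorem stalkCongr_algebraMap_stalkOver {P : Scheme.{u}} (g : P ⟶ Spec (.of Λ))
    {p₁ p₂ : P} (h : p₁ = p₂) (a : Λ) :
    (P.presheaf.stalkCongr (.of_eq h)).hom (algebraMap Λ (StalkOver g p₁) a) =
      algebraMap Λ (StalkOver g p₂) a :=
  congrArg (fun f => f a) (stalkCongr_hom_comp_algebraMap_stalkOver g h)

/-- **The `A`-structure of `StalkOver (g ≫ Spec β) p` is the `Λ`-structure of `StalkOver g p`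
composed with `β : A → Λ`.** [folklore] -/
theorem algebraMap_stalkOver_comp_specMap {A : Type u} [CommRing A] {P : Scheme.{u}}
    (g : P ⟶ Spec (.of Λ)) (β : A →+* Λ) (p : P) :
    (algebraMap A (StalkOver (g ≫ Spec.map (CommRingCat.ofHom β)) p) : A →+* _) =
      (algebraMap Λ (StalkOver g p)).comp β := by
  have key : Spec.map (CommRingCat.ofHom (algebraMap A
      (StalkOver (g ≫ Spec.map (CommRingCat.ofHom β)) p))) =
      Spec.map (CommRingCat.ofHom ((algebraMap Λ (StalkOver g p)).comp β)) := by
    rw [← fromSpecStalk_comp_eq, CommRingCat.ofHom_comp, Spec.map_comp]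
    erw [← fromSpecStalk_comp_eq g p]
    rw [stalkOver_fromSpec_eq, stalkOver_fromSpec_eq, Category.assoc]
    rfl
  exact congrArg CommRingCat.Hom.hom (Spec.map_injective key)

/-- **For `Spec S → Spec Λ` given by `ψ : Λ → S`, the `Λ`-structure of `𝒪_{Spec S, s}` is
`Λ → S → S_s`** (`toStalk`). [folklore] -/
theorem algebraMap_stalkOver_specMap {S : Type u} [CommRing S] (ψ : Λ →+* S) (s : Spec (.of S)) :
    (algebraMap Λ (StalkOver (Spec.map (CommRingCat.ofHom ψ)) s) : Λ →+* _) =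
      (StructureSheaf.toStalk S s).hom.comp ψ := by
  have key : Spec.map (CommRingCat.ofHom (algebraMap Λ (StalkOver (Spec.map (CommRingCat.ofHom ψ)) s))) =
      Spec.map (CommRingCat.ofHom ((StructureSheaf.toStalk S s).hom.comp ψ)) := by
    rw [← fromSpecStalk_comp_eq, stalkOver_fromSpec_eq, CommRingCat.ofHom_comp, Spec.map_comp,
      CommRingCat.ofHom_hom]
    erw [← Spec.fromSpecStalk_eq']
    rfl
  exact congrArg CommRingCat.Hom.hom (Spec.map_injective key)

/-- `toStalk` followed by Mathlib's `Spec.stalkIso` is the localization map. [folklore] -/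
theorem toStalk_comp_stalkIso_hom {S : CommRingCat.{u}} (s : PrimeSpectrum S) :
    StructureSheaf.toStalk S s ≫ (Spec.stalkIso S s).hom =
      CommRingCat.ofHom (algebraMap S (Localization.AtPrime s.asIdeal)) := by
  have h1 : StructureSheaf.toStalk S s = (Scheme.ΓSpecIso S).inv ≫ (Spec S).presheaf.germ ⊤ s trivial := by
    apply Spec.map_injective
    rw [← Spec.fromSpecStalk_eq', Spec.fromSpecStalk_eq]
    rfl
  rw [h1]
  erw [Category.assoc, Spec.germ_stalkMapIso_hom]
  rw [Iso.inv_hom_id_assoc]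

/-- **The stalk of `Spec S` at `s` is the localization `S_s`, compatibly with a structure map
`ψ : Λ → S`.** [folklore] -/
theorem exists_stalk_ringEquiv_localization_specMap {S : Type u} [CommRing S] (ψ : Λ →+* S)
    (s : PrimeSpectrum S) :
    ∃ ε : StalkOver (Spec.map (CommRingCat.ofHom ψ)) s ≃+* Localization.AtPrime s.asIdeal,
      ∀ a : Λ, ε (algebraMap Λ _ a) = algebraMap S _ (ψ a) := by
  refine ⟨(Spec.stalkIso (.of S) s).commRingCatIsoToRingEquiv, fun a => ?_⟩
  rw [algebraMap_stalkOver_specMap]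
  have h := congrArg (fun f => f.hom (ψ a)) (toStalk_comp_stalkIso_hom (S := .of S) s)
  simp only [CommRingCat.hom_comp, RingHom.comp_apply, CommRingCat.hom_ofHom] at h
  exact h

/-- **Transport of a localization along a ring isomorphism of the base ring**: if
`e : R ≃+* S` and `𝔔 = e⁻¹(𝔮)`, then `S_𝔮 ≅ R_𝔔` compatibly with `e`. [folklore] -/
theorem exists_localization_ringEquiv_of_ringEquiv {R S : Type u} [CommRing R] [CommRing S]
    (e : R ≃+* S) (𝔮 : Ideal S) [𝔮.IsPrime] :
    ∃ ε : Localization.AtPrime 𝔮 ≃+* Localization.AtPrime (𝔮.comap e.toRingHom),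
      ∀ r : R, ε (algebraMap S _ (e r)) = algebraMap R _ r := by
  have H : (𝔮.comap e.toRingHom).primeCompl.map e.toMonoidHom = 𝔮.primeCompl := by
    ext x
    simp only [Submonoid.mem_map, Ideal.mem_primeCompl_iff, Ideal.mem_comap,
      RingEquiv.toRingHom_eq_coe, RingHom.coe_coe]
    constructor
    · rintro ⟨y, hy, rfl⟩
      exact hy
    · intro hx
      exact ⟨e.symm x, by rwa [e.apply_symm_apply], e.apply_symm_apply x⟩
  let ε₀ : Localization.AtPrime (𝔮.comap e.toRingHom) ≃+* Localization.AtPrime 𝔮 :=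
    IsLocalization.ringEquivOfRingEquiv (M := (𝔮.comap e.toRingHom).primeCompl)
      (T := 𝔮.primeCompl) (Localization.AtPrime (𝔮.comap e.toRingHom)) (Localization.AtPrime 𝔮) e H
  refine ⟨ε₀.symm, fun r => ?_⟩
  rw [RingEquiv.symm_apply_eq]
  exact (IsLocalization.ringEquivOfRingEquiv_eq H r).symm

/-- **A ring isomorphism of local rings induces an isomorphism of the completions, extending it.**
[folklore] -/
theorem exists_localCpl_equiv_of_ringEquiv {R S : Type u} [CommRing R] [CommRing S]
    [IsLocalRing R] [IsLocalRing S] (ε : R ≃+* S) :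
    ∃ E : LocalCpl R ≃+* LocalCpl S, ∀ r : R, E (AdicCompletion.of _ _ r) = AdicCompletion.of _ _ (ε r) :=
  ⟨adicCompletionCongr _ _ ε (map_maximalIdeal_of_ringEquiv ε), fun r => adicCompletionCongr_of _ _ ε _ r⟩

end StalkOverTools

end Summit.ResolutionOfSingularities.ResolutionOfSingularities.Theorems

end
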